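import Summits.QuantumAdvantage.QuantumAdvantage.Theorems.CharDialFieldColD
import Summits.QuantumAdvantage.QuantumAdvantage.Theorems.CharDialFieldColE
import Summits.QuantumAdvantage.QuantumAdvantage.Theorems.CharDialRankRate
import HarnessLib

/-!
# CharDial / JLinPeel — FIELD COLUMNS, part F: the ROBUST RANK ESCAPE of `fieldY`; `fieldY` is in the class of the fifth residual
(route `CharDial`, item 32604; lens-6 node g18 §10.4 (c) + §10.5)

* `qpre n Z j = (R+1)·Z·(j+1) + R` — prefix parameters of the `cubeRate n + 1` PIVOT CUTS (constant column, spacing `Z`), `qpre_mod`.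
* ★★ `field_not_span_eventually` (every prime `p`, every `α`, all `n ≥ n₀(p)`): NO `log₂ n`-junta presentation of `fieldY p n α` meets the rank
  dial's hypothesis, inlined verbatim from the annex (`SpanHyp`: the presented forms of the cuts with non-constant table lie in the span of `cubeRate n`
  vectors).  ZONE PIVOTS (port of the annex's `res2_not_spanHyp_robust`, §38j): with `Z = sepM / ((R+1)(cubeRate n + 1)) − 1 > (cubeRate n + 1)·log₂ n + 1`
  (from `cubeRate_admissible (60p)`), zone `j` = `[p·((R+1)Zj + R), p·qpre j)` has length `≥ Z` and so contains a coordinate free of ALL the pivot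
  cuts' juntas; by part E's rigidity the presented vector of cut `j` is non-zero there (sensitive: prefix) while those of the cuts `j' < j` vanish
  there (ignored zone, `< p·sepM`) — a triangular system: `cubeRate n + 1` linearly independent vectors in a `cubeRate n`-dimensional span.
* ★★★★ `fieldY_class5_eventually` (every prime `p ≥ 5`, all `n ≥ n₀(p)`): SOME `fieldY p n α` is `log₂ n`-junta ⊕ one-form presentable (canonically
  junta-free), on the HIGH side of the variation dial at threshold `4(log₂ n+1)`, and in EVERY `log₂ n`-junta presentation escapes the RANK dial's,
  the SPARSE-free-set dial's and the MASKED-block (⊇ null ⊇ block) dial's hypotheses — the four inlined verbatim from the annex (`SpanHyp`, `SparseHyp`,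
  `MaskHyp`, `LowVar dialB` over the tree's `SegMove.lowPositions`).  I.e. the hypothesis class of the fifth residual of route `CharDial`'s lens-6
  node is INHABITED — Prop-free form; the Theses-level `residualHigh5_class_inhabited` is four `Iff.rfl` readbacks away (after the annex is split
  under the farm cap).

What this is NOT: a hardness statement — whether `fieldY` is HARD for `log₂ n`-junta ⊕ one-form strategies (a sixth dial) or is the Smolensky
core of the residual is the next node's question.  0 sorry.
-/

set_option autoImplicit false

namespace Summit.QuantumAdvantage.AdviceFreeQNC0.JLinPeel.FieldCol

open Finset MaskDial BlockDial

/-! #### (10) the ROBUST RANK ESCAPE: zone pivots along the constant-column prefix cuts -/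
section Rank
variable (p : ℕ) [hp : Fact p.Prime]
open SegMove

/-- prefix parameter of the `j`-th pivot cut at spacing `Z`: `(R+1)·Z·(j+1) + R ≡ R (mod R+1)`. -/
def qpre (n Z j : ℕ) : ℕ := (rk n + 1) * (Z * (j + 1)) + rk n

omit hp in
/-- `qpre ≡ R (mod R+1)`. -/
theorem qpre_mod (n Z j : ℕ) : qpre n Z j % (rk n + 1) = rk n := by
  unfold qpre
  rw [Nat.mul_add_mod, Nat.mod_eq_of_lt (Nat.lt_succ_self _)]

/-- **ROBUST RANK ESCAPE of `fieldY`** (every prime `p`, all `n ≥ n₀(p)`, every `α`): NO `log₂ n`-junta presentation of `fieldY p n α` meets the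
rank dial's hypothesis, inlined verbatim from the annex (`SpanHyp`: the presented forms of the cuts with non-constant table lie in the span of
`cubeRate n` vectors).  Zone pivots: the `cubeRate n + 1` constant-column prefix cuts `p·qpre n Z j` at spacing `Z > (cubeRate n + 1)·log₂ n` have,
by rigidity (i)/(ii), presented coefficient vectors that are non-zero on their own zone's junta-free coordinate and zero on the later zones' —
a triangular, hence linearly independent, system of `cubeRate n + 1` vectors inside a `cubeRate n`-dimensional span. -/
theorem field_not_span_eventually : ∃ n₀ : ℕ, ∀ n ≥ n₀, ∀ α : GaloisField p (rk n), ∀ D : JLinData p n,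
    D.strat = fieldY p n α → (∀ g, (D.J g).card ≤ Nat.log 2 n) →
    ¬ (∃ A : Fin (cubeRate n) → Fin n → ZMod p,
        ∀ g, ¬ (∀ (u : Fin n → Bool) (s s' : ZMod p), D.h g u s = D.h g u s') →
          ∃ l : Fin (cubeRate n) → ZMod p, D.a g = fun i => ∑ j, l j * A j i) := by
  classical
  have hp0 : 0 < p := hp.out.pos
  have hp1 : 1 ≤ p := hp0
  obtain ⟨n₁, hn₁⟩ := cubeRate_admissible (60 * p)
  refine ⟨max n₁ 2, fun n hn α D hD hJ => ?_⟩
  have hadm := hn₁ n (le_trans (le_max_left _ _) hn)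
  have hn2 : 2 ≤ n := le_trans (le_max_right _ _) hn
  have hL1 : 1 ≤ Nat.log 2 n := Nat.log_pos (by norm_num) hn2
  set L := Nat.log 2 n with hLdef
  set R' := cubeRate n + 1 with hR'
  set M := NullDial.sepM p n with hMdef
  have hR'1 : 1 ≤ R' := by omega
  -- the spacing
  set Z := M / ((rk n + 1) * R') - 1 with hZdef
  have hMn : p * M ≤ n / 3 := NullDial.p_mul_sepM_le p n
  have hn3 : 3 * (n / 3) ≤ n := Nat.mul_div_le n 3
  -- (a) `Z ≥ R'·L + 2` from admissibility `60·p·R'^3·L^4 ≤ n`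
  have hbigM : (rk n + 1) * R' * (R' * L + 3) ≤ M := by
    rw [hMdef]; unfold NullDial.sepM
    rw [Nat.le_div_iff_mul_le hp0, Nat.le_div_iff_mul_le (by norm_num : 0 < 3)]
    have hrk : rk n + 1 ≤ 5 * L ^ 2 := by unfold rk; rw [← hLdef]; nlinarith
    have h2 : R' * L + 3 ≤ 4 * (R' * L) := by nlinarith
    have h3 : R' * L ≤ R' * L ^ 2 := by
      have : L ≤ L ^ 2 := by nlinarith
      exact Nat.mul_le_mul_left _ this
    calc (rk n + 1) * R' * (R' * L + 3) * p * 3 = 3 * p * ((rk n + 1) * (R' * (R' * L + 3))) := by ring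
      _ ≤ 3 * p * ((5 * L ^ 2) * (R' * (4 * (R' * L ^ 2)))) :=
          Nat.mul_le_mul_left _ (Nat.mul_le_mul hrk (Nat.mul_le_mul_left _ (le_trans h2 (Nat.mul_le_mul_left _ h3))))
      _ = 60 * p * (R' * R') * L ^ 4 := by ring
      _ ≤ 60 * p * R' ^ 3 * L ^ 4 := by
          have hRR : R' * R' ≤ R' ^ 3 := by rw [pow_succ, pow_two]; exact Nat.le_mul_of_pos_right _ (by omega)
          exact Nat.mul_le_mul_right _ (Nat.mul_le_mul_left _ hRR)
      _ ≤ n := hadm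
  have hZ3 : R' * L + 3 ≤ M / ((rk n + 1) * R') := by
    rw [Nat.le_div_iff_mul_le (Nat.mul_pos (Nat.succ_pos _) (by omega))]
    calc (R' * L + 3) * ((rk n + 1) * R') = (rk n + 1) * R' * (R' * L + 3) := by ring
      _ ≤ M := hbigM
  have hZ : R' * L + 2 ≤ Z := by rw [hZdef]; omega
  have hZM : (rk n + 1) * R' * (Z + 1) ≤ M := by
    have h := Nat.div_mul_le_self M ((rk n + 1) * R')
    have e : Z + 1 = M / ((rk n + 1) * R') := by rw [hZdef]; omega
    rw [e, mul_comm]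
    exact h
  -- (b) the tail is big: `p + L ≤ #tailC`
  have htail : p + L ≤ (tailC p n).card := by
    have h1 : n - p * M ≤ (tailC p n).card := card_tailC p n
    have h2 : 3 * p + 3 * L ≤ 2 * n := by
      have : R' ^ 3 * L ^ 4 ≥ 1 := Nat.one_le_iff_ne_zero.mpr (by positivity)
      have : L ≤ R' ^ 3 * L ^ 4 := by
        calc L ≤ L ^ 4 := le_self_pow (by omega) (by norm_num)
          _ ≤ R' ^ 3 * L ^ 4 := Nat.le_mul_of_pos_left _ (by positivity)
      nlinarith
    omega
  have hbigTail : ∀ g, p + (D.J g).card ≤ (tailC p n).card := fun g => le_trans (Nat.add_le_add_left (hJ g) p) htail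
  -- (c) the pivot cuts
  have hqM : ∀ j : Fin R', qpre n Z j.val + 1 ≤ M := by
    intro j
    unfold qpre
    have hj : j.val + 1 ≤ R' := j.isLt
    have h1 : (rk n + 1) * (Z * (j.val + 1)) ≤ (rk n + 1) * (Z * R') := Nat.mul_le_mul_left _ (Nat.mul_le_mul_left _ hj)
    have e : (rk n + 1) * R' * (Z + 1) = (rk n + 1) * (Z * R') + (rk n + 1) * R' := by ring
    have h2 : rk n + 1 ≤ (rk n + 1) * R' := Nat.le_mul_of_pos_right _ (by omega)
    omega
  have hfit : ∀ j : Fin R', p * qpre n Z j.val ≤ n := by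
    intro j
    have := Nat.mul_le_mul_left p (hqM j)
    have e : p * (qpre n Z j.val + 1) = p * qpre n Z j.val + p := by ring
    omega
  let gr : Fin R' → Fin (n + 1) := fun j => gpre p n (qpre n Z j.val) (hfit j)
  have hgr_div : ∀ j : Fin R', (gr j).val / p = qpre n Z j.val := fun j => gpre_div p n _ (hfit j)
  have hlt : ∀ j : Fin R', (D.J (gr j)).card < (tailC p n).card := fun j => by have := hbigTail (gr j); omega
  rintro ⟨A, hA⟩
  let S : Submodule (ZMod p) (Fin n → ZMod p) := Submodule.span (ZMod p) (Set.range A)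
  have hmem : ∀ j : Fin R', D.a (gr j) ∈ S := by
    intro j
    obtain ⟨l, hl⟩ := hA (gr j) (pre_active p n α _ (hfit j) (qpre_mod n Z j.val) D hD (hlt j))
    rw [hl, Submodule.mem_span_range_iff_exists_fun]
    refine ⟨l, ?_⟩
    funext i
    simp [Finset.sum_apply, Pi.smul_apply, smul_eq_mul]
  let U : Finset (Fin n) := univ.biUnion fun j : Fin R' => D.J (gr j)
  have hU : U.card ≤ R' * L := by
    have := Finset.card_biUnion_le_card_mul (univ : Finset (Fin R')) (fun j : Fin R' => D.J (gr j)) L (fun j _ => hJ (gr j))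
    rw [card_univ, Fintype.card_fin] at this
    exact this
  -- zone `j` = `[p·((R+1)·Z·j + R), p·qpre j)`, of length `p·(R+1)·Z ≥ Z > #U`
  have hfree : ∀ j : Fin R', ∃ i : Fin n, p * ((rk n + 1) * (Z * j.val) + rk n) ≤ i.val ∧ i.val < p * qpre n Z j.val ∧ i ∉ U := by
    intro j
    by_contra h
    push Not at h
    set lo := p * ((rk n + 1) * (Z * j.val) + rk n) with hlo
    have hlen : lo + Z ≤ p * qpre n Z j.val := by
      rw [hlo]; unfold qpre
      have e : p * ((rk n + 1) * (Z * (j.val + 1)) + rk n) = p * ((rk n + 1) * (Z * j.val) + rk n) + p * ((rk n + 1) * Z) := by ring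
      rw [e]
      have : Z ≤ p * ((rk n + 1) * Z) := by
        calc Z = 1 * (1 * Z) := by ring
          _ ≤ p * ((rk n + 1) * Z) := Nat.mul_le_mul hp1 (Nat.mul_le_mul_right _ (by omega))
      omega
    have hj1 : p * qpre n Z j.val ≤ n := hfit j
    let zone : Finset (Fin n) := univ.filter fun i : Fin n => lo ≤ i.val ∧ i.val < p * qpre n Z j.val
    have hzU : zone ⊆ U := fun i hi => h i (mem_filter.1 hi).2.1 (mem_filter.1 hi).2.2
    have hzcard : Z ≤ zone.card := by
      let f : Fin Z → Fin n := fun k => ⟨lo + k.val, by have := k.isLt; omega⟩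
      have hcard : (univ : Finset (Fin Z)).card = Z := by simp
      rw [← hcard]
      refine Finset.card_le_card_of_injOn f ?_ ?_
      · intro k _
        rw [mem_coe, mem_filter]
        refine ⟨mem_univ _, by show lo ≤ lo + k.val; omega, ?_⟩
        show lo + k.val < p * qpre n Z j.val
        have := k.isLt; omega
      · intro k _ k' _ hkk
        have := congrArg Fin.val hkk
        exact Fin.ext (by simpa [f] using this)
    have h1 := card_le_card hzU
    omega
  choose ifree hifree using hfree
  have hiU : ∀ (j j' : Fin R'), ifree j ∉ D.J (gr j') := by
    intro j j' hmem'
    exact (hifree j).2.2 (mem_biUnion.2 ⟨j', mem_univ _, hmem'⟩)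
  have hli : LinearIndependent (ZMod p) (fun j : Fin R' => D.a (gr j)) := by
    rw [Fintype.linearIndependent_iff]
    intro c hc
    by_contra hne
    push Not at hne
    obtain ⟨j₁, hj₁⟩ := hne
    let NZ : Finset (Fin R') := univ.filter fun j => c j ≠ 0
    have hNZ : NZ.Nonempty := ⟨j₁, mem_filter.2 ⟨mem_univ _, hj₁⟩⟩
    have hjm_mem : c (NZ.max' hNZ) ≠ 0 := (mem_filter.1 (NZ.max'_mem hNZ)).2
    have hgt : ∀ j : Fin R', NZ.max' hNZ < j → c j = 0 := by
      intro j hj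
      by_contra hcj
      have : j ≤ NZ.max' hNZ := NZ.le_max' j (mem_filter.2 ⟨mem_univ _, hcj⟩)
      exact absurd hj (not_lt.mpr this)
    set jm := NZ.max' hNZ with hjm
    have h := congrFun hc (ifree jm)
    simp only [Finset.sum_apply, Pi.smul_apply, smul_eq_mul, Pi.zero_apply] at h
    rw [Finset.sum_eq_single jm] at h
    · have hsens : (ifree jm).val < p * qpre n Z jm.val ∨ p * NullDial.sepM p n ≤ (ifree jm).val := Or.inl (hifree jm).2.1
      have hnz : D.a (gr jm) (ifree jm) ≠ 0 :=
        pre_coef_ne_zero p n α _ (hfit jm) (qpre_mod n Z jm.val) D hD (ifree jm) hsens (hiU jm jm)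
      exact hjm_mem ((mul_eq_zero.1 h).resolve_right hnz)
    · intro j _ hj
      rcases lt_or_gt_of_ne hj with hlt | hgt'
      · have h1 : p * qpre n Z j.val ≤ (ifree jm).val := by
          have hjj : j.val + 1 ≤ jm.val := hlt
          have hle : qpre n Z j.val ≤ (rk n + 1) * (Z * jm.val) + rk n := by
            unfold qpre
            have := Nat.mul_le_mul_left (rk n + 1) (Nat.mul_le_mul_left Z hjj)
            omega
          exact le_trans (Nat.mul_le_mul_left p hle) (hifree jm).1
        have h2 : (ifree jm).val < p * NullDial.sepM p n := by
          have := (hifree jm).2.1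
          have h3 := Nat.mul_le_mul_left p (hqM jm)
          have e : p * (qpre n Z jm.val + 1) = p * qpre n Z jm.val + p := by ring
          rw [← hMdef]
          omega
        rw [pre_coef_eq_zero p n α _ (hfit j) (qpre_mod n Z j.val) D hD (hbigTail _) (ifree jm) h1 h2 (hiU jm j), mul_zero]
      · rw [hgt j hgt', zero_mul]
    · intro h; exact absurd (mem_univ jm) h
  let w : Fin R' → S := fun j => ⟨D.a (gr j), hmem j⟩
  have hw : LinearIndependent (ZMod p) w := LinearIndependent.of_comp S.subtype hli
  have h1 := hw.fintype_card_le_finrank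
  have h2 : Module.finrank (ZMod p) S ≤ Fintype.card (Fin (cubeRate n)) := finrank_range_le_card A
  rw [Fintype.card_fin] at h1 h2
  omega

end Rank

/-! #### (11) ★★★★ `fieldY` IS IN THE HYPOTHESIS CLASS OF THE FIFTH RESIDUAL (all four robust escapes + HIGH), Prop-free -/
section ClassFive
variable (p : ℕ) [hp : Fact p.Prime]
open SegMove

/-- ★★★★ **class(RES⁵) is INHABITED, Prop-free form** (every prime `p ≥ 5`, all `n ≥ n₀(p)`): some `fieldY p n α` is `log₂ n`-junta ⊕ one-form
presentable (canonically junta-free), on the HIGH side of the variation dial at threshold `4(log₂ n + 1)`, and in EVERY `log₂ n`-junta presentation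
escapes the rank dial's, the sparse-free-set dial's and the masked-block (⊇ null ⊇ block) dial's hypotheses — each inlined verbatim from the annex
(`SpanHyp` l.2498, `SparseHyp` l.2505, `MaskHyp` l.7659, `LowVar dialB` l.458–466 over the tree's `SegMove.lowPositions`).  The Theses-level
corollary `residualHigh5_class_inhabited` is four `Iff.rfl` readbacks away (g19, after the annex is split under the farm cap). -/
theorem fieldY_class5_eventually (h5 : 5 ≤ p) : ∃ n₀ : ℕ, ∀ n ≥ n₀, ∃ α : GaloisField p (rk n),
    (fieldData p n α).strat = fieldY p n α ∧ (∀ g, ((fieldData p n α).J g).card ≤ Nat.log 2 n) ∧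
    ¬ (n ≤ 2 * (lowPositions n (fieldY p n α) (4 * (Nat.log 2 n + 1))).card) ∧
    ∀ D : JLinData p n, D.strat = fieldY p n α → (∀ g, (D.J g).card ≤ Nat.log 2 n) →
      ¬ (∃ A : Fin (cubeRate n) → Fin n → ZMod p,
          ∀ g, ¬ (∀ (u : Fin n → Bool) (s s' : ZMod p), D.h g u s = D.h g u s') →
            ∃ l : Fin (cubeRate n) → ZMod p, D.a g = fun i => ∑ j, l j * A j i) ∧
      ¬ (∃ S : Finset (Fin n), Nat.log 2 n ≤ S.card ∧
          ∀ g, (S.filter fun i => i ∈ D.J g ∨ D.a g i ≠ 0).card ≤ Nat.sqrt S.card) ∧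
      ¬ (∃ (ℓ m M : ℕ) (S : Fin M → ℕ) (Z : Finset (Fin n)), (m % 3 = 1 ∨ m % 3 = 2) ∧
          ((∀ k k' : Fin M, k < k' → S k + ℓ ≤ S k') ∧ (∀ k : Fin M, S k + ℓ ≤ n)) ∧
          (∀ k : Fin M, (zblk ℓ S Z k).card = m) ∧
          2 ^ m * ((Nat.log 2 n + 1) * (Nat.log 2 n + 1) + 1) ≤ M ∧
            ∀ g (k : Fin M), ∑ i ∈ zblk ℓ S Z k, D.a g i = 0) := by
  obtain ⟨n₁, hn₁⟩ := fieldY_high_sparse_mask_eventually p h5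
  obtain ⟨n₂, hn₂⟩ := field_not_span_eventually p
  refine ⟨max n₁ n₂, fun n hn => ?_⟩
  obtain ⟨α, h1, h2, h3, h4⟩ := hn₁ n (le_trans (le_max_left _ _) hn)
  refine ⟨α, h1, h2, h3, fun D hD hJ => ⟨hn₂ n (le_trans (le_max_right _ _) hn) α D hD hJ, h4 D hD hJ⟩⟩

end ClassFive

end Summit.QuantumAdvantage.AdviceFreeQNC0.JLinPeel.FieldCol
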